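/-
Copyright: the b2b-balaban cell (near-miss cell 7), T⁴-continuum fan-out, lineage t4-ne7b-p1 (node U5c COUNT member).
Released under the licence of the surrounding project.
-/
import Summits.QuantumFields.BalabanUV.T4Continuum.Support.CountThresholdUniform
import Summits.QuantumFields.BalabanUV.T4Continuum.Support.LateMergersCount
import Literature.MathematicalPhysics.QuantumFieldTheory.Balaban1983to89.T4MatchingClosureSocket

/-!
# The row's exit with the threshold FIRST; the landed ∃-form recovered; the seam currency

Summits-side support leaf of the T⁴-continuum cell (rung (B)+1 on a FINITE torus only; NOT infinite volume, NOT the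
mass gap, NOT the Clay statement; NOT a proof of the spine estimate NE7b).  Lineage `t4-ne7b-p1` (generation 21),
node U5c; companion of `Support/CountThresholdUniform` (the finding and the named thresholds are documented there).
[folklore] bookkeeping over the lineage's OWN typed carrier; nothing is quoted from print and nothing printed is
asserted; no `[cite:]` tag.

WHAT.  §1 **`exists_irThresholdZ_uniform`**: the row's exit as `∃ x₀, ∀ …` with the threshold quantified BEFORE the
index types, the cells, the event tables, the matching scale, the term families, the two `Regeneration` runs and the run
families — the statement the records describe («ONE K-uniform infrared threshold, constants only»); witness
`CountThresholdUniform.irThresholdZ`.  An `example` re-derives the landed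
`PartnerMultiplicityThreshold.exists_irThreshold_relWeightBoundZ_threshold`, binder list letter for letter, in one line
from `CountThresholdUniform.relWeightBoundZ_of_irThreshold` — so the named ∕ uniform form is the STRONGER statement (the
converse implication is not available: the landed `x₀` may depend on the term families).
§2 **`relWeightBound_shift_of_eventually`** (with the tree's `T4MatchingClosureSocket.relWeightBound_shift`): the chain's
conclusion shape
`∃ K₁ ≥ K₀, RelWeightBound … (if K₁ ≤ K then Bad K t else ∅) (indicator {K₁ ≤ K} W)` shifted by `K₁` is a plain
`RelWeightBound` of the shifted families with the class `Bad` and the weight `W` themselves — the hypothesis `hW` of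
`T4MatchingClosureSocket.hybridNE7_closure'_tail` for the shifted families (that seam shifts the origin once more by
its own `K₀`; origins compose).  §3 THE SAME REPAIR FOR THE [CONV-D] EXIT of this lineage
(`LateMergersCount.exists_irThreshold_relWeightBound_canon_lateMergers`, which has the same binder order — `∃ x₀` after
`Cell`, `Dcap`, `Ncap`, `jstar`, `D`, the term families and the two `Regeneration`s): the late-merger threshold NAMED,
`irThresholdTH sh C L r β₀ D` (`Classical.choose` on `LateMergersBanking.exists_irThresholdTH`, a function of the shape
map, the constants and the horizon `D` only), `bankingTH_of_irThreshold`, and **`relWeightBound_lateMergers_of_irThreshold`**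
= that exit x₀-FREE (proof: the landed x₀-free `exists_relWeightBound_of_bankingTH`, exactly as the landed wrapper).
§4 Sanity: the shift on a trivial datum.

NOT DONE HERE.  Nothing of the walls (ID) G-ne7bp1g9-1, (E2)∕(R1) G-ne7bp1-1.  NE7b discharge: no date.

HONEST DEPENDENCY (cell): continuum YM on T⁴ ⇐ BetaPertH ∧ nine spine estimates (0/9 proved); BetaPertH ⇐ (D1) ∧ (D4)
∧ CAP+tail.  This file changes none of it.
-/

open Finset
open Literature.MathematicalPhysics.QuantumFieldTheory.Balaban1983to89
open T4PersistenceDictionary T4PersistentHistoryCount T4BankedInduction T4PrintedShapeBanking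
open T4WeightBudget T4GlobalDenominator T4LiveClassFibration T4LiveStructureGas T4LiveGasToTerms T4RecordPriceSeam
open T4PartnerMultiplicity
open Summit.QuantumFields.BalabanUV.T4Continuum.PlacementBatch
open Summit.QuantumFields.BalabanUV.T4Continuum.PlacementSkeleton
open Summit.QuantumFields.BalabanUV.T4Continuum.PartnerMultiplicityF
open Summit.QuantumFields.BalabanUV.T4Continuum.PartnerMultiplicityG
open Summit.QuantumFields.BalabanUV.T4Continuum.PartnerMultiplicityZ
open Summit.QuantumFields.BalabanUV.T4Continuum.PartnerMultiplicityFloor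
open Summit.QuantumFields.BalabanUV.T4Continuum.PartnerMultiplicityThreshold
open Summit.QuantumFields.BalabanUV.T4Continuum.Crowding
open Summit.QuantumFields.BalabanUV.T4Continuum.CountThresholdUniform
open T4BranchingRecordsGas T4TaggedShapeBanking T4CanonicalMenus T4CountHorizon T4MatchingClosureSocket
open Summit.QuantumFields.BalabanUV.T4Continuum.LateMergers

namespace Summit.QuantumFields.BalabanUV.T4Continuum.CountThresholdExit

noncomputable section

universe u v w

/-! ## §1 The uniform ∃-form (threshold FIRST), and the landed ∃-form recovered -/

section Uniform

/-- **THE UNIFORM ∃-FORM OF THE ROW'S EXIT**: `∃ x₀` depending on `(C, Kz, p, σ, ε, θ, L, r, β₀)` ONLY, BEFORE the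
index types, the cells, the event tables, the matching scale, the term families, the `Regeneration` runs and the run
families — the statement the records describe («ONE K-uniform infrared threshold, constants only»).  Witness: the named
`irThresholdZ`. [folklore] -/
theorem exists_irThresholdZ_uniform (C : T4PrintedShapeBanking.Consts) {L r : ℕ} {β₀ : ℝ} (h : ThresholdOK C L r β₀)
    {Kz p σ ε θ : ℝ} (hKz : 1 ≤ Kz) (hp : 0 ≤ p) (h0 : 0 < σ) (h1 : σ < 1) (hε : 0 < ε) (hθ : 0 < θ) :
    ∃ x₀ : ℝ, ∀ {γ : Type u} {κ : Type v} {ι : Type w} [DecidableEq γ] [DecidableEq κ] {l₀ : ℝ} {K₀ : ℕ}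
      {π : ℕ → ι → κ}
      {T : ℕ → Finset ι} {A A' : ℕ → ℝ → ι → ℝ} {Bad' : ℕ → ℝ → Finset κ} {dead dead' : ℕ → ℝ → ι → ℝ}
      {F Rf F' Rf' : ℕ → κ → ℝ} {nlow nup mlow mup : ℕ → ℝ → ℝ} {Cn : ℝ}
      (Cell : ℕ → ℕ → Finset γ) {V Λ : ℝ}, 0 ≤ V → 0 < Λ →
      (∀ K a, ((Cell K a).card : ℝ) ≤ V * Λ ^ a) → ∀ (E B : ℕ → ℕ → Finset PEv),
      (∀ K j, ∀ e ∈ E K j, PEv.step e ∈ Ioc j K) → ∀ (jstar : ℕ → ℕ), (∀ K, jstar K ≤ K) → ∀ {c : ℝ}, 0 < c →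
      (∀ K : ℕ, c * K ≤ ((K - jstar K : ℕ) : ℝ)) →
      Regeneration l₀ π T A Bad' dead F Rf nlow nup Cn K₀ →
      Regeneration l₀ π T A' Bad' dead' F' Rf' mlow mup Cn K₀ → 0 ≤ Cn →
      ∀ (R : ℕ → ℕ → ℕ) (g : ℕ → ℕ → ℝ) (β' : ℕ → ℝ),
      (∀ K, K₀ ≤ K → B14.FlowIneq27 (g K) (β' K) β₀ C.p₀ K) →
      (∀ K, K₀ ≤ K → B14FlowStep.FlowIneq29 (R K) (g K) L (β' K) β₀ K) →
      (∀ K, K₀ ≤ K → ∀ s, s ≤ K → B14.IsRj L r (g K s) (R K s)) →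
      (∀ K, K₀ ≤ K → ∀ s, s ≤ K → 1 ≤ Real.log ((g K s) ^ 2)⁻¹) →
      (∀ K, K₀ ≤ K → x₀ ≤ Real.log ((g K K) ^ 2)⁻¹) →
      ∀ {ρbar ηbar : ℝ}, (∀ K j, ∑ b ∈ B K j, rho C (g K) b ≤ ρbar) →
      (∀ K j, ∀ t ∈ Ioc j K, ∑ e ∈ E K j with PEv.step e = t, eta C e ≤ ηbar) →
      Λ * Real.exp (ηbar - C.κ₁) < 1 →
      ∀ {Λ' : ℝ}, 0 ≤ Λ' → Λ' * Real.exp ε * Real.exp (-C.κ₁) ≤ 1 →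
      ∀ (y : ℕ → ℕ → γ → PEv → Finset PEv → ℝ),
      (∀ K, ∀ j ≤ K, ∀ z ∈ Cell K (K - j), ∀ b ∈ B K j,
        ∀ Q ∈ records (dictW (R K) C.n₁) j K (E K j) b, 0 ≤ y K j z b Q) →
      (∀ K, K₀ ≤ K → ∀ j ≤ K, ∀ z ∈ Cell K (K - j), ∀ b ∈ B K j,
        ∀ Q ∈ records (dictW (R K) C.n₁) j K (E K j) b,
        y K j z b Q ≤ 0 ∨ ∃ G : Gen PEv, Consistent C K (R K) G ∧ G.WF (dictW (R K) C.n₁) ∧ G.rootStep = j ∧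
          K < G.reach (dictW (R K) C.n₁) ∧ G.root = b ∧ G.events.erase G.root = Q ∧
          y K j z b Q ≤ Kz ^ (merges G).card * (∏ e ∈ merges G, Crowding.Q (wcnt G) σ e.step ^ p) *
            Λ' ^ partnerAges PEv.step G * (Real.exp (-credits (credit C (g K)) G) *
              Real.exp (lifeCost (dictW (R K) C.n₁) (cost C K (R K)) G))) →
      ∀ (str : ℕ → κ → Finset (Slot γ PEv)),
      (∀ K t, |t| ≤ l₀ → K₀ ≤ K → Set.InjOn (str K) (Bad' K t)) →
      (∀ K t, |t| ≤ l₀ → K₀ ≤ K → ∀ c ∈ Bad' K t,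
        str K c ⊆ liveSlots Cell (dictW (R K) C.n₁) E B K ∧
          ∃ o ∈ oldSlots Cell (dictW (R K) C.n₁) E B jstar K, o ∈ str K c) →
      (∀ K t, |t| ≤ l₀ → K₀ ≤ K → ∀ c ∈ Bad' K t, F K c * Rf K c ≤ famWeight (slotPrice (y K)) (str K c)) →
      (∀ K t, |t| ≤ l₀ → K₀ ≤ K → ∀ c ∈ Bad' K t, F' K c * Rf' K c ≤ famWeight (slotPrice (y K)) (str K c)) →
      ∃ K₁, K₀ ≤ K₁ ∧ RelWeightBound l₀ T A A' (fun K t => if K₁ ≤ K then badOfClass π T Bad' K t else ∅)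
        (Set.indicator {K | K₁ ≤ K} (fun K => Cn * recordsBudget ρbar C.κ₁ V Λ ηbar jstar K)) :=
  ⟨irThresholdZ C Kz p σ ε θ L r β₀, fun Cell _ _ hV hΛ hcell E B hE jstar hj _ hc hfrac hA hA' hCn R g β' h27 h29
    hR hx1 hir _ _ hρbar hηbar hr _ hΛ0 hΛ1 y hy0 hlabZ str hinj hstr hF hF' =>
    relWeightBoundZ_of_irThreshold h hKz hp h0 h1 hε hθ Cell hV hΛ hcell E B hE jstar hj hc hfrac hA hA' hCn R g β'
      h27 h29 hR hx1 hir hρbar hηbar hr hΛ0 hΛ1 y hy0 hlabZ str hinj hstr hF hF'⟩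

variable {γ κ ι : Type*} [DecidableEq γ] [DecidableEq κ] {l₀ : ℝ} {K₀ : ℕ} {π : ℕ → ι → κ} {T : ℕ → Finset ι}
  {A A' : ℕ → ℝ → ι → ℝ} {Bad' : ℕ → ℝ → Finset κ} {dead dead' : ℕ → ℝ → ι → ℝ} {F Rf F' Rf' : ℕ → κ → ℝ}
  {nlow nup mlow mup : ℕ → ℝ → ℝ} {Cn : ℝ}

/- **THE LANDED ∃-FORM RECOVERED** (so the named form is the STRONGER statement): the statement of
`PartnerMultiplicityThreshold.exists_irThreshold_relWeightBoundZ_threshold`, letter for letter, re-derived from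
`relWeightBoundZ_of_irThreshold` with the witness `irThresholdZ C Kz p σ ε θ L r β₀` (an `example`, not a second copy of
the landed declaration). [folklore] -/
example (C : T4PrintedShapeBanking.Consts) (hC : C.Valid)
    {Kz p σ ε θ : ℝ} (hKz : 1 ≤ Kz) (hp : 0 ≤ p) (h0 : 0 < σ) (h1 : σ < 1) (hε : 0 < ε) (hθ : 0 < θ)
    (ha : 0 < C.a) (hA₀ : 0 < C.A₀) {L r : ℕ} (hL : 1 ≤ L) {β₀ : ℝ} (hβ : 0 ≤ β₀) (hrq : r * (C.q' + 1) < C.p₀)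
    (Cell : ℕ → ℕ → Finset γ) {V Λ : ℝ} (hV : 0 ≤ V) (hΛ : 0 < Λ)
    (hcell : ∀ K a, ((Cell K a).card : ℝ) ≤ V * Λ ^ a) (E B : ℕ → ℕ → Finset PEv)
    (hE : ∀ K j, ∀ e ∈ E K j, PEv.step e ∈ Ioc j K) (jstar : ℕ → ℕ) (hj : ∀ K, jstar K ≤ K) {c : ℝ} (hc : 0 < c)
    (hfrac : ∀ K : ℕ, c * K ≤ ((K - jstar K : ℕ) : ℝ))
    (hA : Regeneration l₀ π T A Bad' dead F Rf nlow nup Cn K₀)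
    (hA' : Regeneration l₀ π T A' Bad' dead' F' Rf' mlow mup Cn K₀) (hCn : 0 ≤ Cn) :
    ∃ x₀ : ℝ, ∀ (R : ℕ → ℕ → ℕ) (g : ℕ → ℕ → ℝ) (β' : ℕ → ℝ),
      (∀ K, K₀ ≤ K → B14.FlowIneq27 (g K) (β' K) β₀ C.p₀ K) →
      (∀ K, K₀ ≤ K → B14FlowStep.FlowIneq29 (R K) (g K) L (β' K) β₀ K) →
      (∀ K, K₀ ≤ K → ∀ s, s ≤ K → B14.IsRj L r (g K s) (R K s)) →
      (∀ K, K₀ ≤ K → ∀ s, s ≤ K → 1 ≤ Real.log ((g K s) ^ 2)⁻¹) →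
      (∀ K, K₀ ≤ K → x₀ ≤ Real.log ((g K K) ^ 2)⁻¹) →
      ∀ {ρbar ηbar : ℝ}, (∀ K j, ∑ b ∈ B K j, rho C (g K) b ≤ ρbar) →
      (∀ K j, ∀ t ∈ Ioc j K, ∑ e ∈ E K j with PEv.step e = t, eta C e ≤ ηbar) →
      Λ * Real.exp (ηbar - C.κ₁) < 1 →
      ∀ {Λ' : ℝ}, 0 ≤ Λ' → Λ' * Real.exp ε * Real.exp (-C.κ₁) ≤ 1 →
      ∀ (y : ℕ → ℕ → γ → PEv → Finset PEv → ℝ),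
      (∀ K, ∀ j ≤ K, ∀ z ∈ Cell K (K - j), ∀ b ∈ B K j,
        ∀ Q ∈ records (dictW (R K) C.n₁) j K (E K j) b, 0 ≤ y K j z b Q) →
      (∀ K, K₀ ≤ K → ∀ j ≤ K, ∀ z ∈ Cell K (K - j), ∀ b ∈ B K j,
        ∀ Q ∈ records (dictW (R K) C.n₁) j K (E K j) b,
        y K j z b Q ≤ 0 ∨ ∃ G : Gen PEv, Consistent C K (R K) G ∧ G.WF (dictW (R K) C.n₁) ∧ G.rootStep = j ∧
          K < G.reach (dictW (R K) C.n₁) ∧ G.root = b ∧ G.events.erase G.root = Q ∧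
          y K j z b Q ≤ Kz ^ (merges G).card * (∏ e ∈ merges G, Crowding.Q (wcnt G) σ e.step ^ p) *
            Λ' ^ partnerAges PEv.step G * (Real.exp (-credits (credit C (g K)) G) *
              Real.exp (lifeCost (dictW (R K) C.n₁) (cost C K (R K)) G))) →
      ∀ (str : ℕ → κ → Finset (Slot γ PEv)),
      (∀ K t, |t| ≤ l₀ → K₀ ≤ K → Set.InjOn (str K) (Bad' K t)) →
      (∀ K t, |t| ≤ l₀ → K₀ ≤ K → ∀ c ∈ Bad' K t,
        str K c ⊆ liveSlots Cell (dictW (R K) C.n₁) E B K ∧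
          ∃ o ∈ oldSlots Cell (dictW (R K) C.n₁) E B jstar K, o ∈ str K c) →
      (∀ K t, |t| ≤ l₀ → K₀ ≤ K → ∀ c ∈ Bad' K t, F K c * Rf K c ≤ famWeight (slotPrice (y K)) (str K c)) →
      (∀ K t, |t| ≤ l₀ → K₀ ≤ K → ∀ c ∈ Bad' K t, F' K c * Rf' K c ≤ famWeight (slotPrice (y K)) (str K c)) →
      ∃ K₁, K₀ ≤ K₁ ∧ RelWeightBound l₀ T A A' (fun K t => if K₁ ≤ K then badOfClass π T Bad' K t else ∅)
        (Set.indicator {K | K₁ ≤ K} (fun K => Cn * recordsBudget ρbar C.κ₁ V Λ ηbar jstar K)) :=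
  ⟨irThresholdZ C Kz p σ ε θ L r β₀, fun R g β' h27 h29 hR hx1 hir _ _ hρbar hηbar hr _ hΛ0 hΛ1 y hy0 hlabZ str
    hinj hstr hF hF' =>
    relWeightBoundZ_of_irThreshold ⟨hC, ha, hA₀, hL, hβ, hrq⟩ hKz hp h0 h1 hε hθ Cell hV hΛ hcell E B hE jstar hj hc
      hfrac hA hA' hCn R g β' h27 h29 hR hx1 hir hρbar hηbar hr hΛ0 hΛ1 y hy0 hlabZ str hinj hstr hF hF'⟩

end Uniform

/-! ## §2 The seam currency: shift by `K₁`, no indicator -/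

section Shift

variable {ι : Type*} {l₀ : ℝ} {T : ℕ → Finset ι} {A B : ℕ → ℝ → ι → ℝ} {Bad : ℕ → ℝ → Finset ι} {W : ℕ → ℝ}

/-- **THE ROW'S CONCLUSION IN THE SEAM'S CURRENCY.**  From `∃ K₁ ≥ K₀, RelWeightBound … (if K₁ ≤ K then Bad K t else ∅)
(indicator {K₁ ≤ K} W)` (the shape every END statement of the count chain concludes with `Bad := badOfClass π T Bad′`,
`W := Cn·recordsBudget …`): the `K₁`-shifted families carry a plain `RelWeightBound` with the class `Bad` itself and the
weight `W` itself — the hypothesis `hW` of `T4MatchingClosureSocket.hybridNE7_closure'_tail` for the shifted families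
(that seam shifts the origin once more by its own `K₀`; origins compose). [folklore] -/
theorem relWeightBound_shift_of_eventually {K₀ : ℕ}
    (h : ∃ K₁, K₀ ≤ K₁ ∧ RelWeightBound l₀ T A B (fun K t => if K₁ ≤ K then Bad K t else ∅)
      (Set.indicator {K | K₁ ≤ K} W)) :
    ∃ K₁, K₀ ≤ K₁ ∧ RelWeightBound l₀ (fun K => T (K₁ + K)) (fun K => A (K₁ + K)) (fun K => B (K₁ + K))
      (fun K => Bad (K₁ + K)) fun K => W (K₁ + K) := by
  obtain ⟨K₁, hK, hW⟩ := h
  refine ⟨K₁, hK, ?_⟩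
  have hs := relWeightBound_shift K₁ hW
  have h1 : ∀ K t, (if K₁ ≤ K₁ + K then Bad (K₁ + K) t else ∅) = Bad (K₁ + K) t := fun K t =>
    if_pos (Nat.le_add_right K₁ K)
  have h2 : ∀ K, Set.indicator {K | K₁ ≤ K} W (K₁ + K) = W (K₁ + K) := fun K =>
    Set.indicator_of_mem (show K₁ + K ∈ {K | K₁ ≤ K} from Nat.le_add_right K₁ K) W
  exact
    { bad_subset := fun K t ht => by simpa [h1 K t] using hs.bad_subset K t ht
      nonneg := fun K => by simpa [h2 K] using hs.nonneg K
      lt_one := fun K => by simpa [h2 K] using hs.lt_one K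
      summable := by
        have := hs.summable
        exact this.congr fun K => h2 K
      bad_left := fun K t ht => by simpa [h1 K t, h2 K] using hs.bad_left K t ht
      bad_right := fun K t ht => by simpa [h1 K t, h2 K] using hs.bad_right K t ht }

end Shift

/-! ## §3 The [CONV-D] exit (late mergers admitted), threshold named -/

section LateMergers

variable {ε : Type*} [DecidableEq ε]

/-- **THE LATE-MERGER `Banking` THRESHOLD, NAMED**: the witness of `LateMergersBanking.exists_irThresholdTH` chosen once —
a function of the shape map `sh`, the constants `(C, L, r, β₀)` and the horizon `D` only (`0` off the side conditions).
[folklore] -/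
def irThresholdTH (sh : ε → PEv) (C : T4PrintedShapeBanking.Consts) (L r : ℕ) (β₀ : ℝ) (D : ℕ) : ℝ :=
  haveI := Classical.dec (ThresholdOK C L r β₀)
  if h : ThresholdOK C L r β₀ then
    Classical.choose (exists_irThresholdTH sh C h.valid h.a_pos h.A₀_pos h.one_le_L h.β₀_nonneg h.rq_lt D)
  else 0

/-- its specification: along every run of the typed flow with `irThresholdTH sh C L r β₀ D ≤ log g_K⁻²` the late-merger
data inhabit `Banking (ConsistentTH sh C K R D) (padW (dictWT sh R C.n₁) D) …` [folklore] -/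
theorem bankingTH_of_irThreshold (sh : ε → PEv) {C : T4PrintedShapeBanking.Consts} {L r : ℕ} {β₀ : ℝ}
    (h : ThresholdOK C L r β₀) (D K : ℕ) (R : ℕ → ℕ) (g : ℕ → ℝ) (β' : ℝ) (h27 : B14.FlowIneq27 g β' β₀ C.p₀ K)
    (h29 : B14FlowStep.FlowIneq29 R g L β' β₀ K) (hR : ∀ s, s ≤ K → B14.IsRj L r (g s) (R s))
    (hx1 : ∀ s, s ≤ K → 1 ≤ Real.log ((g s) ^ 2)⁻¹) (hir : irThresholdTH sh C L r β₀ D ≤ Real.log ((g K) ^ 2)⁻¹) :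
    Banking (ConsistentTH sh C K R D) (padW (dictWT sh R C.n₁) D) (costT sh C K R) (credit C g ∘ sh)
      (fun e => C.κ₁ * ((bankW sh R C.n₁ D e : ℕ) : ℝ) + Emarg C (sh e)) (reserve C g ∘ sh) (extnT sh C K R) := by
  have hdef : irThresholdTH sh C L r β₀ D =
      Classical.choose (exists_irThresholdTH sh C h.valid h.a_pos h.A₀_pos h.one_le_L h.β₀_nonneg h.rq_lt D) := by
    unfold irThresholdTH; rw [dif_pos h]
  have hspec :=
    Classical.choose_spec (exists_irThresholdTH sh C h.valid h.a_pos h.A₀_pos h.one_le_L h.β₀_nonneg h.rq_lt D)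
  exact hspec K R g β' h27 h29 hR hx1 (hdef ▸ hir)

variable {γ κ ι : Type*} [DecidableEq γ] [DecidableEq κ] {l₀ : ℝ} {K₀ : ℕ} {π : ℕ → ι → κ} {T : ℕ → Finset ι}
  {A A' : ℕ → ℝ → ι → ℝ} {Bad' : ℕ → ℝ → Finset κ} {dead dead' : ℕ → ℝ → ι → ℝ} {F Rf F' Rf' : ℕ → κ → ℝ}
  {nlow nup mlow mup : ℕ → ℝ → ℝ} {Cn : ℝ}

/-- **THE [CONV-D] EXIT, THRESHOLD NAMED.**  `LateMergersCount.exists_irThreshold_relWeightBound_canon_lateMergers` with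
`∃ x₀` REPLACED by the named `irThresholdTH sh C L r β₀ D` in the infrared-smallness binder (side conditions bundled as
`ThresholdOK`; `0 < C.μ` kept); binders otherwise VERBATIM; proof = the landed wrapper over the landed x₀-free
`exists_relWeightBound_of_bankingTH`. [folklore] -/
theorem relWeightBound_lateMergers_of_irThreshold (sh : ε → PEv) {C : T4PrintedShapeBanking.Consts} {L r : ℕ}
    {β₀ : ℝ} (h : ThresholdOK C L r β₀) (hμ₀ : 0 < C.μ)
    (Cell : ℕ → ℕ → Finset γ) {V Λ : ℝ} (hV : 0 ≤ V) (hΛ : 0 < Λ)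
    (hcell : ∀ K a, ((Cell K a).card : ℝ) ≤ V * Λ ^ a) (Dcap Ncap : ℕ → ℕ)
    (jstar : ℕ → ℕ) (hj : ∀ K, jstar K ≤ K) {c : ℝ} (hc : 0 < c)
    (hfrac : ∀ K : ℕ, c * K ≤ ((K - jstar K : ℕ) : ℝ)) (D : ℕ) {Δ : ℝ} (hΔ : 1 ≤ Δ)
    (hA : Regeneration l₀ π T A Bad' dead F Rf nlow nup Cn K₀)
    (hA' : Regeneration l₀ π T A' Bad' dead' F' Rf' mlow mup Cn K₀) (hCn : 0 ≤ Cn)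
    (R : ℕ → ℕ → ℕ) (g : ℕ → ℕ → ℝ) (β' : ℕ → ℝ)
    (h27 : ∀ K, K₀ ≤ K → B14.FlowIneq27 (g K) (β' K) β₀ C.p₀ K)
    (h29 : ∀ K, K₀ ≤ K → B14FlowStep.FlowIneq29 (R K) (g K) L (β' K) β₀ K)
    (hR : ∀ K, K₀ ≤ K → ∀ s, s ≤ K → B14.IsRj L r (g K s) (R K s))
    (hx1 : ∀ K, K₀ ≤ K → ∀ s, s ≤ K → 1 ≤ Real.log ((g K s) ^ 2)⁻¹)
    (hir : ∀ K, K₀ ≤ K → irThresholdTH sh C L r β₀ D ≤ Real.log ((g K K) ^ 2)⁻¹)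
    (hP : ∀ K s, 0 ≤ p0Profile C.A₀ C.p₀ (g K s))
    {ηplus : ℝ} (hηplus : 0 ≤ ηplus) (hr : Λ * Real.exp (ηplus - C.κ₁) < 1)
    {Λ' : ℝ} (hΛ0 : 0 ≤ Λ') (h1 : Λ' * Real.exp (-C.κ₁) * Real.exp ηplus < 1)
    (hx : (Real.exp (-C.E₀) + Real.exp (-C.E₀) * birthMass C *
          (Λ' * Real.exp (-C.κ₁) / (1 - Λ' * Real.exp (-C.κ₁) * Real.exp ηplus))) * Real.exp ηplus ≤
        Real.exp ηplus - 1)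
    (y : ℕ → ℕ → γ → Gen PEv → ℝ)
    (hy0 : ∀ K, ∀ j ≤ K, ∀ z ∈ Cell K (K - j), ∀ G ∈ canonFam Dcap Ncap K j, 0 ≤ y K j z G)
    (hlabTH : ∀ K, K₀ ≤ K → ∀ j ≤ K, ∀ z ∈ Cell K (K - j), ∀ G ∈ canonFam Dcap Ncap K j,
      y K j z G ≤ 0 ∨ ∃ G' : Gen ε, ConsistentTH sh C K (R K) D G' ∧ FreshT G' ∧
        K - D < G'.reach (dictWT sh (R K) C.n₁) ∧ relabel (shape ∘ sh) G' = G ∧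
        y K j z G ≤ Δ * (Λ' ^ partnerAges (PEv.step ∘ sh) G' * (Real.exp (-credits (credit C (g K) ∘ sh) G') *
          Real.exp (lifeCost (padW (dictWT sh (R K) C.n₁) D) (costT sh C K (R K)) G'))))
    (str : ℕ → κ → Finset (BSlot γ PEv))
    (hinj : ∀ K t, |t| ≤ l₀ → K₀ ≤ K → Set.InjOn (str K) (Bad' K t))
    (hstr : ∀ K t, |t| ≤ l₀ → K₀ ≤ K → ∀ c ∈ Bad' K t,
      str K c ⊆ bliveSlots Cell (canonFam Dcap Ncap) K ∧
        ∃ o ∈ boldSlots Cell (canonFam Dcap Ncap) jstar K, o ∈ str K c)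
    (hF : ∀ K t, |t| ≤ l₀ → K₀ ≤ K → ∀ c ∈ Bad' K t, F K c * Rf K c ≤ famWeight (bslotPrice (y K)) (str K c))
    (hF' : ∀ K t, |t| ≤ l₀ → K₀ ≤ K → ∀ c ∈ Bad' K t, F' K c * Rf' K c ≤ famWeight (bslotPrice (y K)) (str K c)) :
    ∃ K₁, K₀ ≤ K₁ ∧ RelWeightBound l₀ T A A' (fun K t => if K₁ ≤ K then badOfClass π T Bad' K t else ∅)
      (Set.indicator {K | K₁ ≤ K}
        (fun K => Cn * recordsBudget (Δ * Real.exp (C.κ₁ * (D : ℝ)) * birthMass C) C.κ₁ V Λ ηplus jstar K)) :=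
  exists_relWeightBound_of_bankingTH sh h.valid.κ₁_nonneg R g D
    (fun K hK => bankingTH_of_irThreshold sh h D K (R K) (g K) (β' K) (h27 K hK) (h29 K hK) (hR K hK) (hx1 K hK)
      (hir K hK))
    Cell hV hΛ hcell (fun _ => menuRen) (fun _ => menuMer) (dictB Dcap) (dictB Dcap) Ncap (fun _ t => menuMer_step t)
    (fun K j => sum_dictB_rho_le hμ₀ Dcap K j (hP K j)) (fun _ t => (sum_menuRen_eta C t).le)
    (fun _ t => (sum_menuMer_eta C t).le) (fun K s => sum_dictB_eta_le hμ₀ Dcap K s) hηplus hr hΛ0 h1 hx jstar hj hc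
    hfrac hΔ y hy0 hlabTH str hinj hstr hA hA' hF hF' hCn

end LateMergers

/-! ## §4 Sanity -/

namespace Sanity

/-- the trivial datum (no terms, zero weights) carries a `RelWeightBound` … [folklore] -/
theorem trivial_relWeightBound :
    RelWeightBound (ι := Unit) 1 (fun _ => ∅) (fun _ _ _ => 0) (fun _ _ _ => 0) (fun _ _ => ∅) fun _ => 0 where
  bad_subset K t _ := by simp
  nonneg K := le_rfl
  lt_one K := zero_lt_one
  summable := summable_zero
  bad_left K t _ := by simp
  bad_right K t _ := by simp

/-- … and so do its shifts (the shift lemma on a datum). [folklore] -/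
example : RelWeightBound (ι := Unit) 1 (fun K => (fun _ : ℕ => (∅ : Finset Unit)) (3 + K))
    (fun K => (fun (_ : ℕ) (_ : ℝ) (_ : Unit) => (0 : ℝ)) (3 + K)) (fun K => (fun (_ : ℕ) (_ : ℝ) (_ : Unit) => (0 : ℝ)) (3 + K))
    (fun K => (fun (_ : ℕ) (_ : ℝ) => (∅ : Finset Unit)) (3 + K)) fun K => (fun _ : ℕ => (0 : ℝ)) (3 + K) :=
  relWeightBound_shift 3 trivial_relWeightBound

end Sanity

end

end Summit.QuantumFields.BalabanUV.T4Continuum.CountThresholdExit
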